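import Summits.BirchSwinnertonDyer.Rank1Residual.X2.ClassClosureO9OptimalMemberRiemannSum
import HarnessLib

/-!
# O9 (X2c), NON-SPLIT sub-cell: the engine-currency Riemann-sum certificate on an ARBITRARY member of
# the isogeny class — `|ord_p ϖ| ≤ ord_p (deg ψ)` for a `ℚ`-isogeny `ψ` to the optimal member, reducible
# `E[p]` allowed (cell `b2b-bsdres`, lane CLASS-CLOSURE, seat `cc-typer-6` GEN 11, O9 typer of record;
# sibling of `X2/ClassClosureO9OptimalMemberRiemannSum.lean`; theorems only — no definition, no named
# fact, nothing booked)

HONEST FRAMING (run/shared/lean/b2b/bsd-rank1-residual/, verbatim in every file): the goal of the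
cell is to DELETE the COMBINATION-SHAPED residual classes of the Birch–Swinnerton-Dyer formula for
ALL analytic-rank `≤ 1` elliptic curves over `ℚ` — "full BSD formula for every rank `≤ 1` curve in
class `C`" assembled STRICTLY from published theorems — so that the rank-`≤ 1` remainder becomes
exactly the CONSTRUCTION-SHAPED classes, which are TYPED (missing-input `Prop`s), NOT attempted.
This is not "finishing BSD". Lane CLASS-CLOSURE: research routes; no claim beyond the stated classes;
census / instrument output is EVIDENCE, never a Literature fact; per-pair certificates are
INSTRUMENTATION (E4), never coverage. Every published theorem enters as one of the tree's named
Literature facts BY NAME; nothing about any particular curve is asserted; no label changes; X2c stays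
CONSTRUCTION-SHAPED until referee A rules.

## What this file records

The sibling file discharges the period ratio `ϖ` (`ϖ·Ω(W) = Ω⁺_f`) of the lane's link (α) on the
OPTIMAL member of an isogeny class: there `‖ϖ‖_p = 1` whenever `p ∤ c`, with no hypothesis on
`E[p]`. On O9 (`E[p]` REDUCIBLE) the other members are reached from the optimal one through rational
isogenies whose degrees `p` may divide, and `Ω` changes by the corresponding powers of `p`
(census-ctyper-2 GEN 19, HOME/INBOX 2026-08-21T17:26Z §8: "in O9 … Ω changes by powers of p across
the class, so … `v_p(ϖ) ≥ 1 − n₀` is a per-MEMBER statement"). This file quantifies it from theorems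
already in the tree — `SkinnerUrban2014.exists_int_mul_minRealPeriod_eq_of_isogeny` (the Néron
lattices of two globally minimal models under a `ℚ`-isogeny of degree `d`: `q·Ω₀ = a·Ω₀'` with
`q ∣ d`, `ab = d`; Greenberg–Vatsal 2000 §3 Rem. 3.4's bookkeeping, there used only for `p ∤ d`) and
`X4.realPeriodRat_eq_abs_maninConstant_mul_plusPeriod_of_optimal` (`Ω(W₀) = |c₀|·Ω⁺_f` on the optimal
member):

* `norm_ratCast_varpi_bounds_of_isogeny_optimal` — **for ANY globally minimal member `W` joined to the
  optimal member `W₀` (`Λ_{E₀} = c₀·Λ_f`, `p ∤ c₀`) by a `ℚ`-isogeny `ψ` of degree `d`, `p` odd: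
  `‖d‖_p ≤ ‖ϖ‖_p` and `‖ϖ‖_p·‖d‖_p ≤ 1`**, i.e. `−ord_p d ≤ ord_p ϖ ≤ ord_p d` (`ϖ·n·a·|c₀| = n₀·q`
  with `n, n₀ ∣ 2` the numbers of real components);
* `bsdp_of_cellCNonsplitGV_of_isogeny_optimal_of_thm1_of_neronRiemannSum_lt` — hence, for an engine
  row computed on such a member (`x = κ·ϖ·[·]⁺_f`, `‖κ‖_p = 1`), the engine-currency inequality of
  p291694's consumer must be won by the extra factor `‖d‖_p⁻¹`:
  `X2.CellCNonsplitGV W p` ∧ `p⁻ⁿ/‖d‖_p < ‖RSx 1 n‖` ⟹ `BSD(E,p)` (published named facts as in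
  p291694: A183 `hD`; GV00 at `p ‖ N` `hGV`, flag `GV00-mult-asserted`; Wuthrich Thm. 16 `hWu`; SW
  Thm. 6.1 `hJn`, §4.2 existence `hHn`; GZK; modularity `hpar`).

READING for the lane (EVIDENCE bookkeeping, nothing booked): all 749 O9 window rows are on the curve
numbered `1` = the optimal member (Agashe–Ribet–Stein 2006, appendix Thm. 5.2, `N < 60000`), so the
sibling file's `d = 1` case is the one the current tables meet; this file is the reading rule for any
future row computed on another member (and the reason a tabled unit at index `1`, `n₀ = 1`, does NOT
by itself certify such a row when `p ∣ d`). BSD truth itself is isogeny-invariant (Cassels; tree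
`X2.bsdp_of_isIsogenous_of_bsdp`), which is the cheaper road whenever the optimal member's row exists.
CONDITIONAL theorems; no count moves; the split residue `X2.O9.ExceptionalLeadingTermAt` is untouched.

References: [GreenbergVatsal2000] §3 Rem. 3.4, Thm. (1.3); [SilvermanAEC2009] Thm. VI.4.1 (b);
[CremonaAlgorithms1997] §2.8 (p. 26), §3.7; [EdixhovenManin1991] Prop. 2, §1; [AgasheRibetStein2006]
appendix Thm. 5.2 (p. 633); [Disegni2020] Thm. 1 (§1.2); [SteinWuthrich2013] §3, §4.2, Thm. 6.1;
[Wuthrich2014] Thm. 16; [MazurTateTeitelbaum1986Invent] §I.10, §I.13.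
-/

set_option autoImplicit false

noncomputable section

open scoped Classical MatrixGroups ModularForm

open CongruenceSubgroup WeierstrassCurve Literature.NumberTheory.EllipticCurves
  Literature.NumberTheory.EllipticCurves.ModularForms
  Literature.NumberTheory.EllipticCurves.Rank1Residual
  Literature.NumberTheory.EllipticCurves.Rank1Residual.Typed
  Literature.NumberTheory.EllipticCurves.GreenbergVatsal2000
  Literature.NumberTheory.EllipticCurves.Wuthrich2014
  Literature.NumberTheory.EllipticCurves.SteinWuthrich2013
  Literature.NumberTheory.EllipticCurves.Disegni2020
  Literature.NumberTheory.EllipticCurves.SkinnerUrban2014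

namespace Summit.BirchSwinnertonDyer.Rank1Residual.X2

/-! ### §0. Two `p`-adic norm helpers -/

/-- For an integer `z` not divisible by the prime `p`, `‖z‖_p = 1`. [folklore] -/
private theorem padicNorm_intCast_eq_one_of_not_dvd' {p : ℕ} [Fact p.Prime] {z : ℤ}
    (h : ¬ (p : ℤ) ∣ z) : ‖(z : ℚ_[p])‖ = 1 :=
  le_antisymm (Padic.norm_int_le_one z)
    (not_lt.mp fun hlt ↦ h (Padic.norm_intCast_lt_one_iff.mp hlt))

/-- For a natural number `n ∣ 2` and an odd prime `p`, `‖n‖_p = 1`. [folklore] -/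
private theorem padicNorm_natCast_eq_one_of_dvd_two' {p : ℕ} [Fact p.Prime] (hp2 : p ≠ 2) {n : ℕ}
    (h : n ∣ 2) : ‖(n : ℚ_[p])‖ = 1 := by
  have hpP : p.Prime := Fact.out
  rw [Padic.norm_natCast_eq_one_iff]
  rcases (Nat.dvd_prime Nat.prime_two).mp h with rfl | rfl
  · exact Nat.coprime_one_right p
  · exact (Nat.coprime_primes hpP Nat.prime_two).mpr hp2

variable (W : WeierstrassCurve ℚ) [W.IsElliptic] [W.IsGloballyMinimal] (p : ℕ) [Fact p.Prime]

/-! ### §1. Any member: `|ord_p ϖ| ≤ ord_p (deg ψ)` for an isogeny `ψ` to the optimal member -/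

section Isogeny

variable {W p} {N : ℕ} [NeZero N]

/-- **The period ratio on an arbitrary member of the class (reducible `E[p]` allowed).** Let `W`,
`W₀` be globally minimal elliptic curves over `ℚ` with parametrisation data `D`, `D₀` at level `N`,
`D₀` lattice-OPTIMAL (`Λ_{E₀} = c₀·Λ_f`) with `p ∤ c₀`, `p` odd, and `ψ : W → W₀` a `ℚ`-isogeny of
degree `d`. Then every `ϖ` with `ϖ·Ω(W) = Ω⁺_f` satisfies `‖d‖_p ≤ ‖ϖ‖_p` and `‖ϖ‖_p·‖d‖_p ≤ 1`,
i.e. `−ord_p d ≤ ord_p ϖ ≤ ord_p d`. Proof: `Ω(W) = n·Ω₀(W)`, `Ω(W₀) = n₀·Ω₀(W₀) = |c₀|·Ω⁺_f`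
(`n, n₀ ∣ 2`), and `q·Ω₀(W) = a·Ω₀(W₀)` with `q ∣ d`, `ab = d`
(`SkinnerUrban2014.exists_int_mul_minRealPeriod_eq_of_isogeny`), so `ϖ·n·a·|c₀| = n₀·q` and
`‖ϖ‖_p = ‖q‖_p/‖a‖_p`. (Greenberg–Vatsal 2000, §3, Rem. 3.4 treats the case `p ∤ d`.)
[cite: GreenbergVatsal2000, §3, Remark 3.4] [cite: SilvermanAEC2009, Thm. VI.4.1(b)]
[cite: CremonaAlgorithms1997, §2.8 (p. 26)] -/
theorem norm_ratCast_varpi_bounds_of_isogeny_optimal (hp2 : p ≠ 2)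
    (D : ModularParametrizationData W N) {W₀ : WeierstrassCurve ℚ} [W₀.IsElliptic]
    [W₀.IsGloballyMinimal] (D₀ : ModularParametrizationData W₀ N)
    (hopt : ∀ z ∈ D₀.L.lattice, ∃ w ∈ periodLattice D₀.f, z = D₀.c * w)
    (hc₀ : ¬ (p : ℤ) ∣ D₀.maninConstant) (ψ : Isogeny W W₀) {ϖ : ℚ}
    (hϖ : (ϖ : ℝ) * W.realPeriodRat = plusPeriod D.f) :
    ‖(ψ.degree : ℚ_[p])‖ ≤ ‖((ϖ : ℚ) : ℚ_[p])‖ ∧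
      ‖((ϖ : ℚ) : ℚ_[p])‖ * ‖(ψ.degree : ℚ_[p])‖ ≤ 1 := by
  have hpP : p.Prime := Fact.out
  -- the two data have the same newform
  have hf : D.f = D₀.f := D.isNewformOf.unique (D₀.isNewformOf.of_isIsogenous ⟨ψ⟩)
  -- the lattice step and the optimal-curve step
  obtain ⟨q, a, b, hq0, hqd, hab, hqa⟩ := exists_int_mul_minRealPeriod_eq_of_isogeny D D₀ ψ
  have hΩ₀ := X4.realPeriodRat_eq_abs_maninConstant_mul_plusPeriod_of_optimal D₀ hopt
  have hn := D.realPeriodRat_eq_numRealComponents_mul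
  have hn₀ := D₀.realPeriodRat_eq_numRealComponents_mul
  set n := (W.baseChange ℝ).numRealComponents with hn_def
  set n₀ := (W₀.baseChange ℝ).numRealComponents with hn₀_def
  have hn2 : n ∣ 2 := numRealComponents_dvd_two _
  have hn₀2 : n₀ ∣ 2 := numRealComponents_dvd_two _
  have hpos : 0 < plusPeriod D.f :=
    IsNewform0.plusPeriod_pos_holds D.isNewformOf.1 D.isNewformOf.coeffField_eq_bot
  -- `ϖ n a |c₀| = n₀ q`
  have key : (ϖ : ℝ) * n * a * |(D₀.c : ℝ)| * plusPeriod D.f = (n₀ : ℝ) * q * plusPeriod D.f := by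
    have e1 : (n₀ : ℝ) * ((q : ℝ) * W.realPeriodRat) = (n : ℝ) * a * (|(D₀.c : ℝ)| * plusPeriod D.f) := by
      calc (n₀ : ℝ) * ((q : ℝ) * W.realPeriodRat)
          = n₀ * (q * (n * D.L.minRealPeriod)) := by rw [hn]
        _ = n * n₀ * ((q : ℝ) * D.L.minRealPeriod) := by ring
        _ = n * n₀ * (a * D₀.L.minRealPeriod) := by rw [hqa]
        _ = n * a * (n₀ * D₀.L.minRealPeriod) := by ring
        _ = n * a * W₀.realPeriodRat := by rw [hn₀]
        _ = (n : ℝ) * a * (|(D₀.c : ℝ)| * plusPeriod D.f) := by rw [hΩ₀, hf]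
    calc (ϖ : ℝ) * n * a * |(D₀.c : ℝ)| * plusPeriod D.f
        = (ϖ : ℝ) * ((n : ℝ) * a * (|(D₀.c : ℝ)| * plusPeriod D.f)) := by ring
      _ = (ϖ : ℝ) * ((n₀ : ℝ) * ((q : ℝ) * W.realPeriodRat)) := by rw [e1]
      _ = (n₀ : ℝ) * q * ((ϖ : ℝ) * W.realPeriodRat) := by ring
      _ = (n₀ : ℝ) * q * plusPeriod D.f := by rw [hϖ]
  have key' : (ϖ : ℝ) * n * a * |(D₀.c : ℝ)| = (n₀ : ℝ) * q := mul_right_cancel₀ hpos.ne' key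
  have keyQ : ϖ * (n : ℚ) * (a : ℚ) * ((|D₀.c| : ℤ) : ℚ) = (n₀ : ℚ) * (q : ℚ) := by
    have h : ((ϖ * (n : ℚ) * (a : ℚ) * ((|D₀.c| : ℤ) : ℚ) : ℚ) : ℝ) = (((n₀ : ℚ) * (q : ℚ) : ℚ) : ℝ) := by
      push_cast
      rw [← key']
    exact_mod_cast h
  have keyP : ((ϖ : ℚ) : ℚ_[p]) * (n : ℚ_[p]) * (a : ℚ_[p]) * ((|D₀.c| : ℤ) : ℚ_[p]) =
      (n₀ : ℚ_[p]) * (q : ℚ_[p]) := by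
    have h := congrArg (Rat.cast : ℚ → ℚ_[p]) keyQ
    simpa only [Rat.cast_mul, Rat.cast_intCast, Rat.cast_natCast] using h
  -- norms: `‖ϖ‖ ‖a‖ = ‖q‖`
  have hnn : ‖(n : ℚ_[p])‖ = 1 := padicNorm_natCast_eq_one_of_dvd_two' hp2 hn2
  have hnn₀ : ‖(n₀ : ℚ_[p])‖ = 1 := padicNorm_natCast_eq_one_of_dvd_two' hp2 hn₀2
  have hnc : ‖((|D₀.c| : ℤ) : ℚ_[p])‖ = 1 :=
    padicNorm_intCast_eq_one_of_not_dvd' fun h ↦ hc₀ ((dvd_abs _ _).mp h)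
  have hnorm : ‖((ϖ : ℚ) : ℚ_[p])‖ * ‖(a : ℚ_[p])‖ = ‖(q : ℚ_[p])‖ := by
    have h := congrArg (‖·‖) keyP
    simp only [norm_mul, hnn, hnn₀, hnc, mul_one, one_mul] at h
    exact h
  -- `‖d‖ ≤ ‖q‖`, `‖d‖ = ‖a‖ ‖b‖`, `‖a‖, ‖b‖ ≤ 1`
  have hdZ : ((ψ.degree : ℤ) : ℚ_[p]) = (ψ.degree : ℚ_[p]) := by push_cast; rfl
  have hdq : ‖(ψ.degree : ℚ_[p])‖ ≤ ‖(q : ℚ_[p])‖ := by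
    obtain ⟨q', hq'⟩ := hqd
    rw [← hdZ, hq', Int.cast_mul, norm_mul]
    exact mul_le_of_le_one_right (norm_nonneg _) (Padic.norm_int_le_one q')
  have hdab : ‖(ψ.degree : ℚ_[p])‖ = ‖(a : ℚ_[p])‖ * ‖(b : ℚ_[p])‖ := by
    rw [← hdZ, ← hab, Int.cast_mul, norm_mul]
  have ha1 : ‖(a : ℚ_[p])‖ ≤ 1 := Padic.norm_int_le_one a
  have hb1 : ‖(b : ℚ_[p])‖ ≤ 1 := Padic.norm_int_le_one b
  refine ⟨?_, ?_⟩
  · calc ‖(ψ.degree : ℚ_[p])‖ ≤ ‖(q : ℚ_[p])‖ := hdq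
      _ = ‖((ϖ : ℚ) : ℚ_[p])‖ * ‖(a : ℚ_[p])‖ := hnorm.symm
      _ ≤ ‖((ϖ : ℚ) : ℚ_[p])‖ * 1 := mul_le_mul_of_nonneg_left ha1 (norm_nonneg _)
      _ = ‖((ϖ : ℚ) : ℚ_[p])‖ := mul_one _
  · calc ‖((ϖ : ℚ) : ℚ_[p])‖ * ‖(ψ.degree : ℚ_[p])‖
        = (‖((ϖ : ℚ) : ℚ_[p])‖ * ‖(a : ℚ_[p])‖) * ‖(b : ℚ_[p])‖ := by rw [hdab, mul_assoc]
      _ = ‖(q : ℚ_[p])‖ * ‖(b : ℚ_[p])‖ := by rw [hnorm]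
      _ ≤ 1 * 1 := mul_le_mul (Padic.norm_int_le_one q) hb1 (norm_nonneg _) zero_le_one
      _ = 1 := mul_one _

/-- **Sub-cell `X2.CellCNonsplitGV` ∧ a `ℚ`-isogeny of degree `d` to the OPTIMAL member ∧ ONE
engine-currency Riemann sum won by the factor `‖d‖_p⁻¹` ⟹ `BSD(E,p)`.** For an ARBITRARY member `W`
(the engine ran on `W`: `x = κ·ϖ·[·]⁺_f`, `ϖ·Ω(W) = Ω⁺_f`, `‖κ‖_p = 1`) with `ψ : W → W₀` to the
optimal member (`Λ_{E₀} = c₀·Λ_f`, `p ∤ c₀`): `‖ϖ‖_p ≤ ‖d‖_p⁻¹`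
(`norm_ratCast_varpi_bounds_of_isogeny_optimal`), so `p⁻ⁿ/‖d‖_p < ‖RSx 1 n‖` gives `p⁻ⁿ < ‖RS 1 n‖`
and p291694 applies. (BSD truth itself is isogeny-invariant — Cassels; this is only the reading of
an engine row computed on a non-optimal member.) CONDITIONAL; nothing booked.
[cite: GreenbergVatsal2000, §3, Remark 3.4] [cite: Disegni2020, Thm. 1 (§1.2)]
[cite: SteinWuthrich2013, Thm. 6.1 (p. 20), §3, §4.2] -/
theorem bsdp_of_cellCNonsplitGV_of_isogeny_optimal_of_thm1_of_neronRiemannSum_lt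
    (hD : thm1_padicBSD_rankOne_multiplicative) (hGV : lambdaMu_multiplicative_of_gvPar)
    (hWu : thm16_charIdeal_dvd_multiplicative_of_reducible) (hJn : thm61_nonsplitMultiplicative)
    (hHn : exists_isMultCanonical) (hGZK : rank_eq_analyticRank_of_analyticRank_le_one)
    (hpar : nonempty_modularParametrizationData) (hc : CellCNonsplitGV W p)
    (D : ModularParametrizationData W N) {W₀ : WeierstrassCurve ℚ} [W₀.IsElliptic]
    [W₀.IsGloballyMinimal] (D₀ : ModularParametrizationData W₀ N)
    (hopt : ∀ z ∈ D₀.L.lattice, ∃ w ∈ periodLattice D₀.f, z = D₀.c * w)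
    (hc₀ : ¬ (p : ℤ) ∣ D₀.maninConstant) (ψ : Isogeny W W₀)
    {x : ℚ → ℚ} {κ ϖ : ℚ} (hκ : ‖((κ : ℚ) : ℚ_[p])‖ = 1)
    (hϖ : (ϖ : ℝ) * W.realPeriodRat = plusPeriod D.f) (hx : ∀ r, x r = κ * ϖ * ratPlusSymbol D.f r)
    {RSx : ℕ → ℕ → ℚ_[p]}
    (hRSx : ∀ k n : ℕ, RSx k n =
      ∑ᶠ ξ : rootsOfUnity (torsionOrder p) ℤ_[p], ∑ s : ZMod (p ^ n),
        (fun (n : ℕ) (a : ZMod (p ^ n)) ↦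
            (-1 : ℚ_[p]) ^ n * (x ((a.val : ℚ) / (p : ℚ) ^ n) : ℚ_[p]))
          (n + cyclotomicExponent p)
            (PadicInt.toZModPow (n + cyclotomicExponent p) ((ξ : ℤ_[p]ˣ) : ℤ_[p]) *
              (cyclotomicGenerator p : ZMod (p ^ (n + cyclotomicExponent p))) ^ s.val) *
          ((s.val.choose k : ℕ) : ℚ_[p]))
    {n : ℕ} (hlt : (p : ℝ) ^ (-n : ℤ) / ‖(ψ.degree : ℚ_[p])‖ < ‖RSx 1 n‖) : BSDp W p := by
  obtain ⟨RS, hRS, hscale⟩ := exists_riemannSumNonsplit_eq_mul (p := p) D.f hx hRSx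
  have hb := norm_ratCast_varpi_bounds_of_isogeny_optimal hc.1.2.1 D D₀ hopt hc₀ ψ hϖ
  have hdpos : 0 < ‖(ψ.degree : ℚ_[p])‖ :=
    norm_pos_iff.mpr (Nat.cast_ne_zero.mpr ψ.degree_pos.ne')
  have h1 : ‖RSx 1 n‖ = ‖((ϖ : ℚ) : ℚ_[p])‖ * ‖RS 1 n‖ := by
    rw [hscale 1 n, norm_mul, Rat.cast_mul, norm_mul, hκ, one_mul]
  have h2 : ‖((ϖ : ℚ) : ℚ_[p])‖ * ‖RS 1 n‖ ≤ ‖RS 1 n‖ / ‖(ψ.degree : ℚ_[p])‖ := by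
    rw [le_div_iff₀ hdpos]
    calc ‖((ϖ : ℚ) : ℚ_[p])‖ * ‖RS 1 n‖ * ‖(ψ.degree : ℚ_[p])‖
        = (‖((ϖ : ℚ) : ℚ_[p])‖ * ‖(ψ.degree : ℚ_[p])‖) * ‖RS 1 n‖ := by ring
      _ ≤ 1 * ‖RS 1 n‖ := mul_le_mul_of_nonneg_right hb.2 (norm_nonneg _)
      _ = ‖RS 1 n‖ := one_mul _
  have h3 : (p : ℝ) ^ (-n : ℤ) / ‖(ψ.degree : ℚ_[p])‖ < ‖RS 1 n‖ / ‖(ψ.degree : ℚ_[p])‖ :=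
    (h1 ▸ hlt).trans_le h2
  have h4 : (p : ℝ) ^ (-n : ℤ) < ‖RS 1 n‖ := (div_lt_div_iff_of_pos_right hdpos).mp h3
  exact bsdp_of_cellC_of_not_split_of_gvPar_of_thm1_of_riemannSum_lt W p D hRS hD hGV hWu hJn hHn
    hGZK hpar hc h4

end Isogeny

end Summit.BirchSwinnertonDyer.Rank1Residual.X2

end
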